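import Literature.MathematicalPhysics.QuantumFieldTheory.MatrixTreeTheorem
import Literature.MathematicalPhysics.QuantumFieldTheory.IncidenceMatrixRank
import HarnessLib

/-!
# Volkov 2016 (ЖЭТФ 149, 1164 = JETP 122, 1008) §5.2: «all coefficients of the polynomial S − V·z_e are negative» — the cancellation of the separating-2-tree polynomial `S` against `V·z_e` by the injection 2-tree ↦ (1-tree, electron line), PROVED for every edge list

independent recomputation; certified where stated, statistical where stated; no new-physics claim.

CITATION HEADER (venture `QEDPrecision`, cell `pub-qed`, track TROPICAL seat V3a = `pub-qed-trop-v3-lit-1` gen 29; VALUE-FREE: a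
statement about the spanning-tree and separating-2-tree polynomials of an ARBITRARY finite edge list with two marked vertices — no
Feynman integrand, no constant, nothing per Set V family or word). Serves `tropical/view/V3-VOLKOV-DEGREES.md` §A A.14.2 (V16 §5.2's
W/V argument and «the sign statement» quoted there) and A.26.5 / A.35.4 (the one piece of the 2015–2019 CONVERGENCE argument named as
untyped besides the ray criterion: the SUBTRACTION-side power counting rests on W = S − V z_e having coefficients of one sign, which is
what lets §5.1's Утверждение 1 — the tree's `Volkov2016/RayConvergenceCriterion.lean`, a criterion for quotients whose DENOMINATOR HAS
POSITIVE COEFFICIENTS — be applied to the terms C_K F_K/(W/V)^K of §5.1). Companion, other model: `Volkov2020/OnShellDenominatorCircuit.lean`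
(V3b) proves the POINTWISE sign W(z) ≤ 0 of NPB 961 eq. (2.4) by Thomson's principle on the lepton-path circuit; the present file is the
COEFFICIENTWISE statement of the 2016 paper, by the 2016 paper's own combinatorial argument, on the tree's edge-list / incidence-rank
vocabulary (`GraphPeriod.lean`, `IncidenceMatrixRank.lean`, `MatrixTreeTheorem.lean`).

SOURCE [Volkov2016]: С. А. Волков, «Вычитательная процедура для вычисления аномального магнитного момента электрона в КЭД и её
применение для численного расчёта на трёхпетлевом уровне», ЖЭТФ 149 (6) 1164–1191 (2016) = S. A. Volkov, J. Exp. Theor. Phys. 122 (6)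
1008–1031 (2016), doi 10.1134/S1063776116050113 (the full version of arXiv:1507.06435, whose §4 does not contain this argument). Russian
original held by the cell (HOME `data/lit/sources/.cache/zhetf149_1164_Volkov2016/r_149_1164.pdf`, per-page text
`…/journal-pdf-pages/ZhETF149-1164-Volkov2016/pNNNN.txt`, PDF page N = journal page 1163 + N; locators «journal page = pNN:Lnn»).
VERBATIM. §5.1, p.1174 = p11:L243–L256 (the objects): «V — сумма по всем 1-деревьям T графа G произведений z_l по всем хордам T
(1-дерево — это связный подграф G, содержащий все вершины G и не имеющий циклов, хорда — это линия, не принадлежащая данному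
объекту), W = S − V z_e, где S — сумма по всем 2-деревьям, для которых вершины, инцидентные электронным внешним линиям G, лежат в
разных компонентах связности, произведений z_l по хордам данных 2-деревьев, z_e есть сумма z_l по всем электронным линиям G
(2-дерево — это подграф G, содержащий все вершины G, не имеющий циклов и имеющий ровно две компоненты связности).» ⟦V = the sum
over the spanning 1-trees T of G of the products of z_l over the chords of T (a 1-tree is a connected subgraph containing all vertices
and without cycles; a chord is a line not in the object); W = S − V z_e, S = the sum over the 2-trees whose two components separate the
vertices incident to the external electron lines, of the chord products; z_e = the sum of z_l over all electron lines of G (a 2-tree is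
a subgraph containing all vertices, without cycles, with exactly two connected components).⟧ §5.2, p.1176–1177 = p13:L91–L113 and
p14:L1–L12 (the argument and the statement): «Выражение V z_e можно представить как Σ_{(T;l)} z_T z_l, где суммирование ведется по
всем парам, T — 1-дерево, l — электронная линия в G, z_T — произведение z_j на хордах T. Ясно, что для любого 2-дерева, для которого
электронные внешние линии G инцидентны вершинам в разных компонентах связности, можно найти линию из электронного пути,
соединяющего электронные внешние линии G, которое будет соединять компоненты связности данного 2-дерева. Поставим в соответствие
этому 2-дереву пару (T; l), где l — данная линия, T — дерево, получающееся добавлением l к 2-дереву. z_T z_l будет равно произведению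
z_j по хордам 2-дерева, разным 2-деревьям будут сопоставлены разные (T; l). Таким образом, расписав выражение для S − V z_e, можно
сократить все слагаемые из S и часть слагаемых из V z_e; … Отметим также, что данное рассуждение доказывает, что все коэффициенты
полинома S − V z_e отрицательны, это обосновывает возможность использования Утверждения 1 (ниже будет приведен более простой способ
получения данной асимптотики, но он не даст возможности доказать знакопостоянность коэффициентов).» ⟦V z_e = Σ over pairs (T; l),
T a 1-tree, l an electron line, of z_T z_l (z_T = the chord product of T). For every 2-tree separating the external-electron vertices
one can find a line of the electron path joining the external electron lines which joins the two components of the 2-tree; assign to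
the 2-tree the pair (T; l), l this line, T the tree obtained by adding l to the 2-tree. z_T z_l equals the chord product of the 2-tree,
and different 2-trees get different pairs. Hence, writing out S − V z_e, all terms of S cancel against part of the terms of V z_e; …
Note also that this argument proves that ALL COEFFICIENTS OF THE POLYNOMIAL S − V z_e ARE NEGATIVE, which justifies the use of
Proposition 1 (a simpler way to the asymptotics is given below, but it cannot prove the constant sign of the coefficients).⟧

MODEL (the tree's, nothing new): a graph is an edge list `E : Fin N → Fin (V+1) × Fin (V+1)` (Brown's convention of `GraphPeriod.lean`);
a «subgraph containing all vertices» is an edge subset `γ : Finset (Fin N)` with the simple graph `edgeGraph E γ` it spans on ALL `V + 1`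
vertices (`IncidenceMatrixRank.lean`); «1-tree» = `IsSpanningTree E T` (rank form `|T| = V = rk`, = «V lines spanning a connected graph»
by `isSpanningTree_iff_card_eq_and_connected`); «2-tree» = `IsTwoTree E F` := `|F| + 1 = V = rk F + 1` (= loop number 0 and exactly
two components, `isTwoTree_iff`, from Kirchhoff's rank theorem `edgeRank_add_natCard_connectedComponent`); the two «вершины,
инцидентные электронным внешним линиям» are two marked vertices `u w : Fin (V+1)` and «лежат в разных компонентах связности» is
`¬ (edgeGraph E F).Reachable u w` (`IsSepTwoTree`); `V` = `kirchhoffPolynomial R E` (= Σ_T Π_{e∉T} X_e, the matrix-tree theorem of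
`MatrixTreeTheorem.lean`, restated here with the decidable spanning-tree instance as `kirchhoffPolynomial_eq_sum_oneTrees`); `S` =
`twoTreePolynomial R E u w`; `z_e` = `lineSum R P` for a line set `P`; `W` = `wPolynomial R E u w P := S − V·z_P`. THE ONE HYPOTHESIS of
the theorems is `(edgeGraph E P).Reachable u w` — the lines of `P` join `u` to `w` — which the electron lines of a QED graph satisfy
(the «электронный путь, соединяющий электронные внешние линии» lies among them); no connectedness, no `u ≠ w`, no QED structure is
assumed (for `u = w` there is no separating 2-tree and `S = 0`).

WHAT THE KERNEL CERTIFIES (all PROVED; no named fact):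
* `IsSepTwoTree.exists_crossing`, `IsSepTwoTree.isSpanningTree_insert`, `IsSepTwoTree.exists_link` — the two sentences of the pairing:
  a line `l ∈ P` joining the two components of a separating 2-tree exists, it is not a line of the 2-tree, and `F ∪ {l}` is a 1-tree
  (`IsSepTwoTree.mk_eq_or`: a separating 2-tree has exactly the components of `u` and of `w`).
* **`kirchhoff_mul_lineSum_eq_twoTree_add`** — «можно сократить все слагаемые из S и часть слагаемых из V z_e»: `V·z_P = S + Σ_{(T,l)∈Rest}
  (Π_{e∉T} X_e)·X_l` for a set `Rest ⊆ {1-trees} × P` of pairs (the pairs not hit by the injection 2-tree ↦ (2-tree ∪ {l}, l); the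
  injectivity «разным 2-деревьям будут сопоставлены разные (T; l)» is `T ∖ {l} = F`).
* **`coeff_wPolynomial_nonpos`** — «все коэффициенты полинома S − V z_e отрицательны»: `coeff d W ≤ 0` for EVERY exponent `d`, every
  edge list, every `u, w`, every `P` joining them, over any ordered commutative ring; `coeff_wPolynomial_neg_of_mem_support` (every
  occurring coefficient is `< 0`, Volkov's wording); `coeff_twoTreePolynomial_le` (`S ≤ V z_P` coefficientwise);
  `coeff_kirchhoff_mul_lineSum_sub_nonneg` (`V z_P − S` has non-negative coefficients — the «положительные коэффициенты» shape in
  which Утверждение 1 takes a denominator); `eval_wPolynomial_nonpos` (hence `W(x) ≤ 0` on the closed positive orthant).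
NOT CLAIMED: that the Feynman-parametric denominator of a magnetic-moment term IS `(W/V)^K` with this `W` (§5.1's derivation from (13),
§2.3; NPB 961 §2.2); the ORDER statements of §5.2 («S − V z_e по порядку не превосходит δ²V», «W/V ≍ δ²», the pair attaining `δ²V`),
which are asymptotics along the IR vector, not coefficient facts; anything per graph of the cell. presearch (g29): the coefficient
comparison `S ≤ V·z_P` is not in the held corpus (Bogner–Weinzierl 2010 / Brown–Yeats spanning forest polynomials give the objects, not
this comparison; `lit search --hybrid`, `lit galaxy search` 2026-08-25) — cited to its printed source only.
-/

namespace Literature.MathematicalPhysics.QuantumFieldTheory.Volkov2016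

open MvPolynomial
open Literature.MathematicalPhysics.QuantumFieldTheory

variable {N V : ℕ}

/-! ## 2-trees (two-component spanning forests) and separating 2-trees -/

section TwoTrees

variable (E : Fin N → Fin (V + 1) × Fin (V + 1))

/-- «2-дерево — это подграф G, содержащий все вершины G, не имеющий циклов и имеющий ровно две компоненты связности»
⟦a 2-tree is a subgraph of G containing all vertices of G, without cycles and with exactly two connected components⟧, in the
tree's rank form (as `IsSpanningTree`): `V − 1` lines whose incidence rows have rank `V − 1` (⇔ loop number `0` and exactly two
components on all `V + 1` vertices, `isTwoTree_iff`). [cite: Volkov2016, §5.1 p.1174 (definition of 2-trees, after eq. for W)] -/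
def IsTwoTree (F : Finset (Fin N)) : Prop :=
  F.card + 1 = V ∧ edgeRank E F + 1 = V

/-- The 2-trees «для которых вершины, инцидентные электронным внешним линиям G, лежат в разных компонентах связности»
⟦for which the vertices incident to the external electron lines of G lie in different connected components⟧: the two marked
vertices `u`, `w` are not joined in the graph spanned by `F`. [cite: Volkov2016, §5.1 p.1174 (definition of S)] -/
def IsSepTwoTree (u w : Fin (V + 1)) (F : Finset (Fin N)) : Prop :=
  IsTwoTree E F ∧ ¬ (edgeGraph E F).Reachable u w

/-- Rank form = printed form: `F` is a 2-tree iff its loop number (first Betti number `|F| − rk`) vanishes («не имеющий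
циклов») and the graph it spans on all `V + 1` vertices has exactly two connected components («ровно две компоненты
связности»). [cite: Volkov2016, §5.1 p.1174 (definition of 2-trees)] -/
theorem isTwoTree_iff (F : Finset (Fin N)) :
    IsTwoTree E F ↔ loopNumber E F = 0 ∧ Nat.card (edgeGraph E F).ConnectedComponent = 2 := by
  have h1 := edgeRank_add_natCard_connectedComponent E F
  have h2 := loopNumber_add_eq E F
  have h3 := edgeRank_le_card E F
  unfold IsTwoTree
  unfold loopNumber at h2 ⊢
  constructor
  · rintro ⟨hc, hr⟩
    omega
  · rintro ⟨hl, hcc⟩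
    omega

/-- The graph spanned by an edge subset grows with the subset. [folklore] -/
private theorem edgeGraph_mono {γ γ' : Finset (Fin N)} (h : γ ⊆ γ') : edgeGraph E γ ≤ edgeGraph E γ' := by
  intro u v huv
  rw [edgeGraph_adj] at huv ⊢
  obtain ⟨hne, h'⟩ := huv
  refine ⟨hne, ?_⟩
  rcases h' with ⟨e, he, hE⟩ | ⟨e, he, hE⟩
  · exact Or.inl ⟨e, h he, hE⟩
  · exact Or.inr ⟨e, h he, hE⟩

variable {E}

/-- A separating 2-tree has exactly the two components of `u` and of `w`: every vertex is joined in `⟨F⟩` either to `u` or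
to `w`. [cite: Volkov2016, §5.1 p.1174 (2-trees have exactly two components)] -/
theorem IsSepTwoTree.mk_eq_or {u w : Fin (V + 1)} {F : Finset (Fin N)} (hF : IsSepTwoTree E u w F)
    (x : Fin (V + 1)) :
    (edgeGraph E F).connectedComponentMk x = (edgeGraph E F).connectedComponentMk u ∨
      (edgeGraph E F).connectedComponentMk x = (edgeGraph E F).connectedComponentMk w := by
  have h2 : Nat.card (edgeGraph E F).ConnectedComponent = 2 := ((isTwoTree_iff E F).1 hF.1).2
  have hne : (edgeGraph E F).connectedComponentMk u ≠ (edgeGraph E F).connectedComponentMk w :=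
    fun h => hF.2 (SimpleGraph.ConnectedComponent.exact h)
  rw [Nat.card_eq_two_iff' ((edgeGraph E F).connectedComponentMk u)] at h2
  obtain ⟨y, -, huniq⟩ := h2
  by_cases hx : (edgeGraph E F).connectedComponentMk x = (edgeGraph E F).connectedComponentMk u
  · exact Or.inl hx
  · exact Or.inr ((huniq _ hx).trans (huniq _ hne.symm).symm)

/-- «можно найти линию из электронного пути, соединяющего электронные внешние линии G, которое будет соединять компоненты
связности данного 2-дерева» ⟦one can find a line of the electron path joining the external electron lines of G which joins
the connected components of the given 2-tree⟧: if `u` and `w` are joined by the lines of `P`, some line of `P` has its two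
endpoints in different components of the separating 2-tree `F`. [cite: Volkov2016, §5.2 p.1176 (PDF p.13 L96–L102)] -/
theorem IsSepTwoTree.exists_crossing {u w : Fin (V + 1)} {F : Finset (Fin N)} (hF : IsSepTwoTree E u w F)
    {P : Finset (Fin N)} (hP : (edgeGraph E P).Reachable u w) :
    ∃ l ∈ P, (edgeGraph E F).connectedComponentMk (E l).1 ≠ (edgeGraph E F).connectedComponentMk (E l).2 := by
  by_contra h
  push Not at h
  have h' := (forall_mem_apply_fst_eq_iff E P (edgeGraph E F).connectedComponentMk).1 h
  have h'' := (forall_adj_eq_iff_forall_reachable_eq _ _).1 h' u w hP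
  exact hF.2 (SimpleGraph.ConnectedComponent.exact h'')

/-- A line whose endpoints lie in different components of `⟨F⟩` is not a line of `F`. [folklore] -/
private theorem not_mem_of_crossing {F : Finset (Fin N)} {l : Fin N}
    (hl : (edgeGraph E F).connectedComponentMk (E l).1 ≠ (edgeGraph E F).connectedComponentMk (E l).2) :
    l ∉ F :=
  fun h => hl (connectedComponentMk_fst_eq E h)

/-- «T — дерево, получающееся добавлением l к 2-дереву» ⟦T is the tree obtained by adding l to the 2-tree⟧: adding to a
separating 2-tree a line joining its two components gives a spanning 1-tree («1-дерево — это связный подграф G, содержащий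
все вершины G и не имеющий циклов», the tree's `IsSpanningTree`). [cite: Volkov2016, §5.2 p.1176 (PDF p.13 L102–L105)] -/
theorem IsSepTwoTree.isSpanningTree_insert {u w : Fin (V + 1)} {F : Finset (Fin N)} (hF : IsSepTwoTree E u w F)
    {l : Fin N}
    (hl : (edgeGraph E F).connectedComponentMk (E l).1 ≠ (edgeGraph E F).connectedComponentMk (E l).2) :
    IsSpanningTree E (insert l F) := by
  classical
  rw [isSpanningTree_iff_card_eq_and_connected]
  refine ⟨?_, ?_⟩
  · rw [Finset.card_insert_of_notMem (not_mem_of_crossing hl)]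
    exact hF.1.1
  · have hle : edgeGraph E F ≤ edgeGraph E (insert l F) := edgeGraph_mono E (Finset.subset_insert l F)
    have hab : (E l).1 ≠ (E l).2 := fun h => hl (by rw [h])
    have hadj : (edgeGraph E (insert l F)).Adj (E l).1 (E l).2 :=
      edgeGraph_adj_of_mem E (Finset.mem_insert_self l F) hab
    have key : ∀ x, (edgeGraph E (insert l F)).Reachable x (E l).1 := by
      intro x
      have hx := hF.mk_eq_or x
      have ha := hF.mk_eq_or (E l).1
      have hb := hF.mk_eq_or (E l).2
      have hx' : (edgeGraph E F).connectedComponentMk x = (edgeGraph E F).connectedComponentMk (E l).1 ∨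
          (edgeGraph E F).connectedComponentMk x = (edgeGraph E F).connectedComponentMk (E l).2 := by
        rcases hx with hx | hx <;> rcases ha with ha | ha <;> rcases hb with hb | hb
        all_goals
          first
            | exact absurd (ha.trans hb.symm) hl
            | exact Or.inl (hx.trans ha.symm)
            | exact Or.inr (hx.trans hb.symm)
      rcases hx' with h | h
      · exact (SimpleGraph.ConnectedComponent.exact h).mono hle
      · exact ((SimpleGraph.ConnectedComponent.exact h).mono hle).trans hadj.symm.reachable
    rw [SimpleGraph.connected_iff]
    exact ⟨fun x y => (key x).trans (key y).symm, inferInstance⟩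

/-- Volkov's pairing step in full: for a separating 2-tree `F` and any line set `P` joining `u` to `w` there is a line `l ∈ P`,
not in `F`, such that `F ∪ {l}` is a spanning 1-tree. [cite: Volkov2016, §5.2 p.1176 (PDF p.13 L96–L105)] -/
theorem IsSepTwoTree.exists_link {u w : Fin (V + 1)} {F : Finset (Fin N)} (hF : IsSepTwoTree E u w F)
    {P : Finset (Fin N)} (hP : (edgeGraph E P).Reachable u w) :
    ∃ l ∈ P, l ∉ F ∧ IsSpanningTree E (insert l F) := by
  obtain ⟨l, hlP, hl⟩ := hF.exists_crossing hP
  exact ⟨l, hlP, not_mem_of_crossing hl, hF.isSpanningTree_insert hl⟩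

end TwoTrees

/-! ## The polynomials V, S, z_e, W = S − V·z_e and the cancellation -/

section Polynomials

variable (R : Type*) [CommRing R] (E : Fin N → Fin (V + 1) × Fin (V + 1))

open scoped Classical in
/-- `S` — «сумма по всем 2-деревьям, для которых вершины, инцидентные электронным внешним линиям G, лежат в разных компонентах
связности, произведений z_l по хордам данных 2-деревьев» ⟦the sum over the 2-trees separating the two external-electron
vertices `u`, `w` of the products of `z_l` over their chords⟧ («хорда — это линия, не принадлежащая данному объекту»).
[cite: Volkov2016, §5.1 p.1174 (definition of S, W = S − V z_e)] -/
noncomputable def twoTreePolynomial (u w : Fin (V + 1)) : MvPolynomial (Fin N) R :=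
  ∑ F ∈ Finset.univ.filter (IsSepTwoTree E u w), ∏ e ∈ Fᶜ, X e

/-- `z_e` — «сумма z_l по всем электронным линиям G» ⟦the sum of `z_l` over the electron lines⟧, for an arbitrary line set
`P` (the theorems ask only that the lines of `P` join `u` to `w`, as the electron path of a QED graph does).
[cite: Volkov2016, §5.1 p.1174 (definition of z_e)] -/
noncomputable def lineSum (P : Finset (Fin N)) : MvPolynomial (Fin N) R :=
  ∑ e ∈ P, X e

/-- `W = S − V·z_e`, with `V` = «сумма по всем 1-деревьям T графа G произведений z_l по всем хордам T» = the tree's Kirchhoff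
(first Symanzik) polynomial `kirchhoffPolynomial` (`kirchhoffPolynomial_eq_sum_spanningTrees`).
[cite: Volkov2016, §5.1 p.1174 (W = S − V z_e)] -/
noncomputable def wPolynomial (u w : Fin (V + 1)) (P : Finset (Fin N)) : MvPolynomial (Fin N) R :=
  twoTreePolynomial R E u w - kirchhoffPolynomial R E * lineSum R P

/-- `V` — «сумма по всем 1-деревьям T графа G произведений z_l по всем хордам T» ⟦the sum over the spanning 1-trees T of G
of the products of z_l over the chords of T⟧ — IS the tree's Kirchhoff polynomial: `kirchhoffPolynomial_eq_sum_spanningTrees`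
(matrix-tree theorem, `MatrixTreeTheorem.lean`) restated with the DECIDABLE spanning-tree instance of `IncidenceMatrixRank.lean`
(the imported statement carries the classical one). [cite: Volkov2016, §5.1 p.1174 (definition of V)] -/
theorem kirchhoffPolynomial_eq_sum_oneTrees :
    kirchhoffPolynomial R E = ∑ T ∈ Finset.univ.filter (IsSpanningTree E), ∏ e ∈ Tᶜ, X e := by
  rw [kirchhoffPolynomial_eq_sum_spanningTrees E R]
  exact Finset.sum_congr (Finset.filter_congr_decidable _ _ _) (fun _ _ => rfl)

/-- A product of distinct variables times one more variable is a monomial with coefficient `1`. [folklore] -/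
private theorem prod_X_mul_X_eq_monomial (S : Finset (Fin N)) (l : Fin N) :
    (∏ e ∈ S, (X e : MvPolynomial (Fin N) R)) * X l =
      monomial (∑ e ∈ S, Finsupp.single e 1 + Finsupp.single l 1) 1 := by
  classical
  have hprod : ∀ T : Finset (Fin N), ∏ e ∈ T, (X e : MvPolynomial (Fin N) R) =
      monomial (∑ e ∈ T, Finsupp.single e 1) 1 := by
    intro T
    induction T using Finset.induction_on with
    | empty => rw [Finset.prod_empty, Finset.sum_empty, ← C_apply, C_1]
    | insert a s ha ih =>
      rw [Finset.prod_insert ha, Finset.sum_insert ha, ih,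
        show (X a : MvPolynomial (Fin N) R) = monomial (Finsupp.single a 1) 1 from rfl, monomial_mul, one_mul]
  rw [hprod, show (X l : MvPolynomial (Fin N) R) = monomial (Finsupp.single l 1) 1 from rfl, monomial_mul, one_mul]

variable {E}

open scoped Classical in
/-- **Volkov's cancellation** («Выражение V z_e можно представить как Σ_{(T;l)} z_T z_l … Поставим в соответствие этому 2-дереву
пару (T; l) … z_T z_l будет равно произведению z_j по хордам 2-дерева, разным 2-деревьям будут сопоставлены разные (T; l).
Таким образом, расписав выражение для S − V z_e, можно сократить все слагаемые из S и часть слагаемых из V z_e»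
⟦V z_e = Σ over pairs (T; l), T a 1-tree, l an electron line, of z_T z_l; to a separating 2-tree assign the pair (T; l), l the
path line joining its components, T = the 2-tree plus l; z_T z_l is the chord product of the 2-tree and different 2-trees get
different pairs; so in S − V z_e all terms of S cancel against part of the terms of V z_e⟧): whenever the lines of `P` join
`u` to `w`, `V·z_P = S + Σ_{(T,l) ∈ Rest} z^{chords(T)}·z_l` for a set `Rest` of pairs (spanning 1-tree, line of `P`).
[cite: Volkov2016, §5.2 p.1176 (PDF p.13 L91–L108)] -/
theorem kirchhoff_mul_lineSum_eq_twoTree_add {u w : Fin (V + 1)} {P : Finset (Fin N)}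
    (hP : (edgeGraph E P).Reachable u w) :
    ∃ Rest : Finset (Finset (Fin N) × Fin N),
      Rest ⊆ (Finset.univ.filter (IsSpanningTree E)) ×ˢ P ∧
      kirchhoffPolynomial R E * lineSum R P =
        twoTreePolynomial R E u w + ∑ p ∈ Rest, (∏ e ∈ p.1ᶜ, X e) * X p.2 := by
  set sep := Finset.univ.filter (IsSepTwoTree E u w) with hsep
  set pairs := (Finset.univ.filter (IsSpanningTree E)) ×ˢ P with hpairs
  set g : Finset (Fin N) × Fin N → MvPolynomial (Fin N) R := fun p => (∏ e ∈ p.1ᶜ, X e) * X p.2 with hg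
  have hVz : kirchhoffPolynomial R E * lineSum R P = ∑ p ∈ pairs, g p := by
    rw [hpairs, Finset.sum_product, kirchhoffPolynomial_eq_sum_oneTrees R E, lineSum, Finset.sum_mul_sum]
  by_cases hempty : sep = ∅
  · refine ⟨pairs, subset_rfl, ?_⟩
    rw [hVz, twoTreePolynomial, ← hsep, hempty, Finset.sum_empty, zero_add]
  obtain ⟨F₀, hF₀⟩ := Finset.nonempty_iff_ne_empty.2 hempty
  have hlink : ∀ F ∈ sep, ∃ l ∈ P, l ∉ F ∧ IsSpanningTree E (insert l F) := fun F hF =>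
    IsSepTwoTree.exists_link ((Finset.mem_filter_univ F).1 hF) hP
  obtain ⟨l₀, -, -⟩ := hlink F₀ hF₀
  haveI : Nonempty (Fin N) := ⟨l₀⟩
  choose! link hlinkP hlinkF hlinkT using hlink
  set ι : Finset (Fin N) → Finset (Fin N) × Fin N := fun F => (insert (link F) F, link F) with hι
  have hinj : Set.InjOn ι sep := by
    intro F hF F' hF' h
    simp only [hι, Prod.mk.injEq] at h
    obtain ⟨h1, h2⟩ := h
    calc F = (insert (link F) F).erase (link F) := (Finset.erase_insert (hlinkF F hF)).symm
      _ = (insert (link F') F').erase (link F') := by rw [h1, h2]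
      _ = F' := Finset.erase_insert (hlinkF F' hF')
  have himg : sep.image ι ⊆ pairs := by
    intro p hp
    rw [Finset.mem_image] at hp
    obtain ⟨F, hF, rfl⟩ := hp
    rw [hpairs, Finset.mem_product]
    exact ⟨(Finset.mem_filter_univ _).2 (hlinkT F hF), hlinkP F hF⟩
  have hS : twoTreePolynomial R E u w = ∑ p ∈ sep.image ι, g p := by
    rw [Finset.sum_image hinj, twoTreePolynomial]
    refine Finset.sum_congr rfl fun F hF => ?_
    have hnot : link F ∉ F := hlinkF F hF
    simp only [hg, hι]
    rw [Finset.compl_insert, mul_comm, Finset.mul_prod_erase _ _ (Finset.mem_compl.2 hnot)]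
  refine ⟨pairs \ sep.image ι, Finset.sdiff_subset, ?_⟩
  rw [hVz, hS, ← Finset.sum_sdiff himg, add_comm]

end Polynomials

/-! ## The sign of the coefficients -/

section Coefficients

variable (R : Type*) [CommRing R] [PartialOrder R] [IsOrderedRing R]
variable {E : Fin N → Fin (V + 1) × Fin (V + 1)} {u w : Fin (V + 1)} {P : Finset (Fin N)}

open scoped Classical in
/-- Coefficientwise `S ≤ V·z_e`: every monomial of `S` is cancelled by a monomial of `V z_e`.
[cite: Volkov2016, §5.2 p.1176–1177 (PDF p.13 L106–L108, p.14 L6–L9)] -/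
theorem coeff_twoTreePolynomial_le (hP : (edgeGraph E P).Reachable u w) (d : Fin N →₀ ℕ) :
    coeff d (twoTreePolynomial R E u w) ≤ coeff d (kirchhoffPolynomial R E * lineSum R P) := by
  obtain ⟨Rest, -, hEq⟩ := kirchhoff_mul_lineSum_eq_twoTree_add R hP
  rw [hEq, coeff_add, le_add_iff_nonneg_right, coeff_sum]
  refine Finset.sum_nonneg fun p _ => ?_
  rw [prod_X_mul_X_eq_monomial, coeff_monomial]
  split_ifs
  · exact zero_le_one
  · exact le_rfl

/-- **«все коэффициенты полинома S − V z_e отрицательны»** ⟦all coefficients of the polynomial S − V z_e are negative⟧ —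
non-positive everywhere: `coeff_d W ≤ 0` for every exponent `d`, for every edge list, every pair of marked vertices and every
line set `P` joining them (for `d` in the support the coefficient is `< 0`, `coeff_wPolynomial_neg_of_mem_support`).
[cite: Volkov2016, §5.2 p.1177 (PDF p.14 L6–L12)] -/
theorem coeff_wPolynomial_nonpos (hP : (edgeGraph E P).Reachable u w) (d : Fin N →₀ ℕ) :
    coeff d (wPolynomial R E u w P) ≤ 0 := by
  rw [wPolynomial, coeff_sub, sub_nonpos]
  exact coeff_twoTreePolynomial_le R hP d

/-- Volkov's wording exactly: every coefficient that occurs in `W = S − V z_e` is negative.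
[cite: Volkov2016, §5.2 p.1177 (PDF p.14 L6–L9)] -/
theorem coeff_wPolynomial_neg_of_mem_support (hP : (edgeGraph E P).Reachable u w) {d : Fin N →₀ ℕ}
    (hd : d ∈ (wPolynomial R E u w P).support) : coeff d (wPolynomial R E u w P) < 0 :=
  lt_of_le_of_ne (coeff_wPolynomial_nonpos R hP d) (mem_support_iff.1 hd)

/-- The opposite polynomial `V·z_e − S` has non-negative coefficients — the «положительные коэффициенты» ⟦positive
coefficients⟧ form in which §5.1's Утверждение 1 (the tree's `Volkov2016/RayConvergenceCriterion.lean`) consumes a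
denominator: «это обосновывает возможность использования Утверждения 1». [cite: Volkov2016, §5.2 p.1177 (PDF p.14 L8–L9)] -/
theorem coeff_kirchhoff_mul_lineSum_sub_nonneg (hP : (edgeGraph E P).Reachable u w) (d : Fin N →₀ ℕ) :
    0 ≤ coeff d (kirchhoffPolynomial R E * lineSum R P - twoTreePolynomial R E u w) := by
  rw [coeff_sub, sub_nonneg]
  exact coeff_twoTreePolynomial_le R hP d

/-- Consequently `W(z) ≤ 0` at every point of the closed positive orthant (constant sign of the on-shell denominator).
[cite: Volkov2016, §5.2 p.1177 (PDF p.14 L6–L12)] -/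
theorem eval_wPolynomial_nonpos (hP : (edgeGraph E P).Reachable u w) (x : Fin N → R) (hx : ∀ e, 0 ≤ x e) :
    eval x (wPolynomial R E u w P) ≤ 0 := by
  have h : 0 ≤ eval x (kirchhoffPolynomial R E * lineSum R P - twoTreePolynomial R E u w) := by
    rw [eval_eq]
    refine Finset.sum_nonneg fun d _ => mul_nonneg (coeff_kirchhoff_mul_lineSum_sub_nonneg R hP d) ?_
    exact Finset.prod_nonneg fun i _ => pow_nonneg (hx i) _
  have : wPolynomial R E u w P = -(kirchhoffPolynomial R E * lineSum R P - twoTreePolynomial R E u w) := by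
    rw [wPolynomial, neg_sub]
  rw [this, map_neg, neg_nonpos]
  exact h

end Coefficients

end Literature.MathematicalPhysics.QuantumFieldTheory.Volkov2016
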